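import Mathlib
import HarnessLib
import Summits.RiemannHypothesis.Statement
import Summits.RiemannHypothesis.RiemannHypothesis.Theses.MayerPairing

/-!
# RiemannHypothesis / MayerPairing — conjugation symmetry of the eigenvalue predicate

Route `RiemannHypothesis/MayerPairing`, items stmt-RiemannHypothesis-1470 (`UnitCircleCrossedOnce`)
and stmt-RiemannHypothesis-1473 (`Target`).

Mayer's transfer operator has real structure: `L_{s̄} f* = (L_s f)*` with `f*(z) = conj (f (conj z))`.
In the ζ-free functional-equation form of "μ is an eigenvalue of `L_s`" that the route inlines in
every item, this says: if `(f, δ)` witnesses the eigenvalue `μ` at `s = σ + iτ`, then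
`(f*, min δ 1)` witnesses `conj μ` at `s̄ = σ - iτ` (the shrink to `δ ≤ 1` keeps `z + 1` in the open
right half-plane, where the principal power `(z+1)^{-2s}` commutes with conjugation).

Consequences recorded here:
* `mayerPairing_isEigen_conj` — the symmetry of the inlined predicate;
* `mayerPairing_unitCircleCrossedOnce_of_nonneg` — `UnitCircleCrossedOnce` follows from its
  restriction to heights `τ ≥ 7` (apply the symmetry to the selection `σ ↦ conj (Λ σ)`, which is
  continuous and has the same moduli).

So any proof or certificate for the monotonicity crux only ever needs `τ ≥ 7`.

References: D. Mayer, Comm. Math. Phys. 130 (1990) 311–333 (real structure of `L_β`);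
C.-H. Chang and D. Mayer, Contemp. Math. 290 (2001), (2.47)–(2.49).
-/

namespace Summit.RiemannHypothesis.RiemannHypothesis.Theorems

open Summit.RiemannHypothesis.RiemannHypothesis.Theses.MayerPairing
open scoped ComplexConjugate
open Filter Topology

/-- **Real structure of Mayer's operator, in the inlined eigenvalue predicate.** If `μ` is an
eigenvalue of `L_{σ+iτ}` in the route's ζ-free sense (witness `f` holomorphic on `{Re z > -δ}`,
not identically zero on the right half-plane, three-term functional equation with the principal
power `(z+1)^{-2s}`, and the Chang–Mayer normalisation at `+∞`), then `conj μ` is an eigenvalue of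
`L_{σ-iτ}`, witnessed by `z ↦ conj (f (conj z))` on `{Re z > -min δ 1}`. [folklore] -/
theorem mayerPairing_isEigen_conj {σ τ : ℝ} {μ : ℂ}
    (h : ∃ f : ℂ → ℂ, ∃ δ : ℝ, 0 < δ ∧ DifferentiableOn ℂ f {z : ℂ | -δ < z.re} ∧
      (∃ z : ℂ, 0 < z.re ∧ f z ≠ 0) ∧
      (∀ z : ℂ, -δ < z.re → μ * (f z - f (z + 1)) =
        (z + 1) ^ (-(2 * ((σ : ℂ) + (τ : ℂ) * Complex.I))) * f (1 / (z + 1))) ∧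
      Tendsto (fun x : ℝ => μ * f x - f 0 * ((x : ℂ) + 1) ^ (1 - 2 * ((σ : ℂ) + (τ : ℂ) * Complex.I)) /
        (2 * ((σ : ℂ) + (τ : ℂ) * Complex.I) - 1)) atTop (𝓝 0)) :
    ∃ f : ℂ → ℂ, ∃ δ : ℝ, 0 < δ ∧ DifferentiableOn ℂ f {z : ℂ | -δ < z.re} ∧
      (∃ z : ℂ, 0 < z.re ∧ f z ≠ 0) ∧
      (∀ z : ℂ, -δ < z.re → conj μ * (f z - f (z + 1)) =
        (z + 1) ^ (-(2 * ((σ : ℂ) + ((-τ : ℝ) : ℂ) * Complex.I))) * f (1 / (z + 1))) ∧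
      Tendsto (fun x : ℝ => conj μ * f x - f 0 * ((x : ℂ) + 1) ^ (1 - 2 * ((σ : ℂ) + ((-τ : ℝ) : ℂ) * Complex.I)) /
        (2 * ((σ : ℂ) + ((-τ : ℝ) : ℂ) * Complex.I) - 1)) atTop (𝓝 0) := by
  obtain ⟨f, δ, hδ, hdiff, ⟨z₀, hz₀, hfz₀⟩, hfe, hlim⟩ := h
  -- the conjugate parameter
  set s : ℂ := (σ : ℂ) + (τ : ℂ) * Complex.I with hs
  have hs' : (σ : ℂ) + ((-τ : ℝ) : ℂ) * Complex.I = conj s := by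
    apply Complex.ext <;> simp [hs]
  rw [hs']
  -- the reflected witness
  set g : ℂ → ℂ := fun z => conj (f (conj z)) with hg
  have hopen : IsOpen {z : ℂ | -δ < z.re} := isOpen_lt continuous_const Complex.continuous_re
  refine ⟨g, min δ 1, lt_min hδ one_pos, ?_, ⟨conj z₀, by simpa using hz₀, by simpa [hg] using hfz₀⟩,
    ?_, ?_⟩
  · -- holomorphy of `conj ∘ f ∘ conj`
    intro z hz
    have hz' : -δ < (conj z).re := by
      rw [Complex.conj_re]
      exact lt_of_le_of_lt (neg_le_neg (min_le_left δ 1)) hz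
    have hd : DifferentiableAt ℂ (conj ∘ f ∘ conj) z :=
      differentiableAt_conj_conj_iff.2 (hdiff.differentiableAt (hopen.mem_nhds hz'))
    exact hd.differentiableWithinAt
  · -- the functional equation, conjugated
    intro z hz
    have hzδ : -δ < (conj z).re := by
      rw [Complex.conj_re]
      exact lt_of_le_of_lt (neg_le_neg (min_le_left δ 1)) hz
    have hz1 : 0 < (z + 1).re := by
      rw [Complex.add_re, Complex.one_re]
      have := lt_of_le_of_lt (neg_le_neg (min_le_right δ 1)) hz
      linarith
    have harg : (z + 1).arg ≠ Real.pi := by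
      intro hpi
      have := (Complex.arg_eq_pi_iff.1 hpi).1
      linarith
    have key := hfe (conj z) hzδ
    -- apply `conj` to the functional equation at `conj z`
    have key' := congrArg conj key
    rw [map_mul, map_sub, map_mul] at key'
    have hpow : conj ((conj z + 1) ^ (-(2 * s))) = (z + 1) ^ (-(2 * conj s)) := by
      have h1 : conj z + 1 = conj (z + 1) := by rw [map_add, map_one]
      have h2 : -(2 * conj s) = conj (-(2 * s)) := by
        simp [map_ofNat]
      rw [h1, h2, Complex.cpow_conj _ _ harg]
    have hinv : conj (f (1 / (conj z + 1))) = g (1 / (z + 1)) := by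
      simp only [hg, map_div₀, map_one, map_add]
    have hshift : conj (f (conj z + 1)) = g (z + 1) := by
      simp only [hg, map_add, map_one]
    rw [hpow, hinv, hshift] at key'
    simpa [hg] using key'
  · -- the normalisation at `+∞`, conjugated
    have hconj : Tendsto (fun x : ℝ => conj (μ * f x - f 0 * ((x : ℂ) + 1) ^ (1 - 2 * s) / (2 * s - 1)))
        atTop (𝓝 0) := by
      have := (Complex.continuous_conj.tendsto 0).comp hlim
      rw [map_zero] at this
      exact this
    refine hconj.congr' ?_
    filter_upwards [eventually_gt_atTop (-1 : ℝ)] with x hx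
    have harg : ((x : ℂ) + 1).arg ≠ Real.pi := by
      have hx1 : ((x : ℂ) + 1) = ((x + 1 : ℝ) : ℂ) := by push_cast; ring
      rw [hx1, Complex.arg_ofReal_of_nonneg (by linarith)]
      exact Real.pi_ne_zero.symm
    have hpow : conj (((x : ℂ) + 1) ^ (1 - 2 * s)) = ((x : ℂ) + 1) ^ (1 - 2 * conj s) := by
      have h1 : conj ((x : ℂ) + 1) = (x : ℂ) + 1 := by
        rw [map_add, map_one, Complex.conj_ofReal]
      have h2 : 1 - 2 * conj s = conj (1 - 2 * s) := by
        simp [map_ofNat]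
      rw [h2, Complex.cpow_conj _ _ harg, h1]
    have hden : conj (2 * s - 1) = 2 * conj s - 1 := by
      simp [map_ofNat]
    rw [map_sub, map_mul, map_div₀, map_mul, hpow, hden]
    simp [hg]

/-- **`UnitCircleCrossedOnce` needs only heights `τ ≥ 7`.** By the real structure of Mayer's
operator (`mayerPairing_isEigen_conj`), a continuous eigenvalue selection `Λ` at height `τ ≤ -7`
gives the continuous selection `σ ↦ conj (Λ σ)` at height `-τ ≥ 7` with the same moduli; hence
the crux for `|τ| ≥ 7` follows from the crux for `τ ≥ 7`. [folklore] -/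
theorem mayerPairing_unitCircleCrossedOnce_of_nonneg
    (h : ∀ τ : ℝ, 7 ≤ τ → ∀ a b : ℝ, 0 < a → a < b → b < 1 / 2 → ∀ Λ : ℝ → ℂ,
      ContinuousOn Λ (Set.Icc a b) →
      (∀ σ ∈ Set.Icc a b, ∃ f : ℂ → ℂ, ∃ δ : ℝ, 0 < δ ∧ DifferentiableOn ℂ f {z : ℂ | -δ < z.re} ∧
        (∃ z : ℂ, 0 < z.re ∧ f z ≠ 0) ∧
        (∀ z : ℂ, -δ < z.re → Λ σ * (f z - f (z + 1)) =
          (z + 1) ^ (-(2 * ((σ : ℂ) + (τ : ℂ) * Complex.I))) * f (1 / (z + 1))) ∧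
        Tendsto (fun x : ℝ => Λ σ * f x - f 0 * ((x : ℂ) + 1) ^ (1 - 2 * ((σ : ℂ) + (τ : ℂ) * Complex.I)) /
          (2 * ((σ : ℂ) + (τ : ℂ) * Complex.I) - 1)) atTop (𝓝 0)) →
      ¬ (‖Λ a‖ = 1 ∧ ‖Λ b‖ = 1)) :
    UnitCircleCrossedOnce := by
  unfold UnitCircleCrossedOnce
  intro τ hτ a b ha hab hb Λ hcont heig
  rcases le_or_gt 0 τ with hpos | hneg
  · exact h τ (by rwa [abs_of_nonneg hpos] at hτ) a b ha hab hb Λ hcont heig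
  · -- reflect to height `-τ ≥ 7`
    have hτ' : 7 ≤ -τ := by rwa [abs_of_neg hneg] at hτ
    have hcont' : ContinuousOn (fun σ => conj (Λ σ)) (Set.Icc a b) :=
      Complex.continuous_conj.comp_continuousOn hcont
    have heig' : ∀ σ ∈ Set.Icc a b, ∃ f : ℂ → ℂ, ∃ δ : ℝ, 0 < δ ∧
        DifferentiableOn ℂ f {z : ℂ | -δ < z.re} ∧ (∃ z : ℂ, 0 < z.re ∧ f z ≠ 0) ∧
        (∀ z : ℂ, -δ < z.re → conj (Λ σ) * (f z - f (z + 1)) =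
          (z + 1) ^ (-(2 * ((σ : ℂ) + ((-τ : ℝ) : ℂ) * Complex.I))) * f (1 / (z + 1))) ∧
        Tendsto (fun x : ℝ => conj (Λ σ) * f x - f 0 *
          ((x : ℂ) + 1) ^ (1 - 2 * ((σ : ℂ) + ((-τ : ℝ) : ℂ) * Complex.I)) /
          (2 * ((σ : ℂ) + ((-τ : ℝ) : ℂ) * Complex.I) - 1)) atTop (𝓝 0) :=
      fun σ hσ => mayerPairing_isEigen_conj (heig σ hσ)
    have := h (-τ) hτ' a b ha hab hb (fun σ => conj (Λ σ)) hcont' heig'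
    simpa [Complex.norm_conj] using this

end Summit.RiemannHypothesis.RiemannHypothesis.Theorems
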